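import Literature.Order.Ordinal.NaturalSum
import Literature.Algebra.EuclideanDomain.EuclideanOrderTypeProduct
import Literature.Algebra.EuclideanDomain.EuclideanOrderTypeFinite
import HarnessLib

/-!
# The Euclidean order type of a product: the upper bound `e(R × S) ≤ e(R) ⊕ e(S)` (Clark 2015, Product Theorem)

Topic `Literature/Algebra/EuclideanDomain`, namespace `Literature.Algebra.EuclideanDomain`.  THEOREMS ONLY (no `def`, no
instance, no named fact), all proved, in the vocabulary of `TransfiniteSmallestAlgorithm.lean` (`samuelSet R α = A_α`,
`samuelRank = θ`), `EuclideanOrderTypeIndecomposable.lean` (the Euclidean order type `e(R) = ⨆ z, ((θ z − 1) + 1)`) and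
`Literature/Order/Ordinal/NaturalSum.lean` (the natural sum `nadd α β = α ⊕ β`).  This is the `TODO(general form)` left in
`EuclideanOrderTypeProduct.lean` («the upper bound `e(R × S) ≤ e(R) ⊕ e(S)` (Hessenberg–Brookfield natural sum …)»),
which proves the lower bound `e(R) + e(S) ≤ e(R × S)`.

## Source (read at the page)

P. L. Clark, *A note on Euclidean order types*, Order **32** (2015) 157–178 [Clark2015EuclideanOrderTypes] (materialised
`paper:arxiv-1208.0977`, arXiv numbering), §2.8, VERBATIM: «Theorem 22. (Product Theorem) Let `R₁, …, R_n` be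
Euclidean rings. a) The ring `∏ Rᵢ` is Euclidean iff `Rᵢ` is Euclidean for all `i`. b) If the equivalent conditions of
part a) hold, then `e(R₁) + … + e(R_n) ≤ e(∏ Rᵢ) ≤ e(R₁) ⊕ … ⊕ e(R_n)`.  Proof. Induction reduces us to the case
`n = 2`. … For the second inequality of (7), let `φ₁ : R₁ → e(R₁)`, `φ₂ : R₂ → e(R₂)` be the bottom Euclidean functions
on `R₁` and `R₂`.  By definition of the Hessenberg–Brookfield sum, we have an isotone map
`λ : (e(R₁) + 1) × (e(R₂) + 1) → e(R₁) ⊕ e(R₂)` and thus a Euclidean function `λ ∘ (φ₁ × φ₂) : R → e(R₁) ⊕ e(R₂)`.»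
«Remark 2.7: The upper bound … is essentially due to Nagata. Moreover, in the proof of Proposition 6 of [Samuel71],
Samuel gives the bound `e(R₁ × R₂) ≤ e(R₁) × e(R₂) + e(R₂) × e(R₁)`.»  Conventions (§2.1–§2.5): a Euclidean function is
`φ : R• → Ord` with, for `a ∈ R`, `b ∈ R•`, `q, r` such that `a = qb + r` and `r = 0` or `φ(r) < φ(b)`; it is extended to
`0` by `φ(0) = sup_{x ≠ 0} φ(x) + 1`, the top value; the bottom Euclidean function `φ_R` is `θ − 1` and
`e(R) = φ_R(0)`.  Theorem 25 a): «`e(R) = e(R′) + ℓ(A)`» for `R = R′ × A`, `A` Artinian principal; §2.5 Example: «`e(ℤ) = ω`».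

## What is formalised

* §1 Lemma 9 ([Nagata85]): for «extended» functions `τ_R : R → Ord`, `τ_S : S → Ord` (division with
  `r = 0 ∨ τ(r) < τ(b)`, and `τ(x) < τ(0)` for `x ≠ 0` — the value at `0` on top, (1.11)) the product map into
  `Ord × Ord` with the product order is a generalized Euclidean function (**`Prod.exists_remainder_prod_lt`**, with
  Clark's Case 2/3 trick `r = (y₁, r₂)`: `exists_remainder_le_of_extended`); Lemma 7 (composition with an isotone map,
  `exists_remainder_comp_of_strictMono`); hence «a Euclidean function `λ ∘ (φ₁ × φ₂)`»: the natural sum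
  `(x, y) ↦ τ_R(x) ⊕ τ_S(y)` (**`Prod.exists_remainder_nadd_lt`**).
* §2 **Theorem 22 (b), upper bound: `e(R × S) ≤ e(R) ⊕ e(S)`** for commutative rings `R`, `S` exhausted by their
  transfinite constructions (**`Prod.iSup_samuelRank_le_nadd`**), hence the printed two-sided (7)
  `e(R) + e(S) ≤ e(R × S) ≤ e(R) ⊕ e(S)` (**`Prod.add_le_iSup_samuelRank_le_nadd`**, lower bound from the tree).
* §3 Exact values when one order type is finite (Prop. 4 (a) `α ⊕ n = α + n`): **`Prod.iSup_samuelRank_eq_add_of_lt_omega0`**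
  (`e(S) < ω ⟹ e(R × S) = e(R) + e(S)`, Theorem 25 a)'s mechanism), `Prod.iSup_samuelRank_eq_add_of_finite` (`S` finite),
  `Prod.iSup_samuelRank_eq_add_one_of_field` (`e(R × K) = e(R) + 1`), and the instance `e(ℤ × ℚ) = ω + 1`
  (`iSup_samuelRank_int_prod_rat`).
-- TODO(general form): `n` factors (induction on Clark's (7)) and Samuel's weaker bound `e(R₁) e(R₂) + e(R₂) e(R₁)` are not
-- spelled out.

## Mathlib / tree search

Mathlib: `Prod` ring structure, `RingEquiv.prodComm`, `Ordinal` arithmetic (`Ordinal.sub_le`, `add_lt_add_iff_left`,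
`Order.add_one_le_iff`, `Prod.lt_iff`), `Field.toEuclideanDomain` (for `ℚ`).  Tree: `NaturalSum.lean` (`nadd`, `nadd_strictMono`,
`nadd_lt_nadd_left/right`, `nadd_le_nadd_left/right`, `le_nadd_self`, `nadd_eq_add_of_lt_omega0`, `nadd_natCast`),
`EuclideanOrderTypeProduct.lean` (`iSup_samuelRank_add_iSup_samuelRank_le_prod`), `IntProdIntSmallestAlgorithm.lean`
(`iSup_samuelRank_map_le_of_surjective`), `ProductOfEuclideanRings.lean` (`Prod.forall_exists_mem_samuelSet`),
`EuclideanOrderTypeIndecomposable.lean` (`samuelRank_sub_one_lt_iSup`, `iSup_samuelRank_ne_zero`,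
`iSup_samuelRank_eq_one_of_field`, `Int.iSup_samuelRank_eq_omega0`), `TransfiniteSmallestAlgorithmSuperadditive.lean`
(`one_add_samuelRank_sub_one`), `EuclideanOrderTypeFinite.lean` (`iSup_samuelRank_lt_omega0_of_finite`),
`EuclideanDomainIffTransfiniteConstruction.lean` (`forall_exists_mem_samuelSet_of_euclideanDomain`).
-/

namespace Literature.Algebra.EuclideanDomain

open Ordinal Literature.Order.Ordinal

universe u

/-! ## §1 «a Euclidean function `λ ∘ (φ₁ × φ₂)`» on the product -/

section Division

variable {R S : Type u} [CommRing R] [CommRing S]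

/-- Division by a possibly-zero `x′` for an extended function `τ` (`τ(x) < τ(0)` for `x ≠ 0`): `x = x′q + r` with
`τ(r) ≤ τ(x′)`, and either `τ(r) < τ(x′)` or `x′ ∣ x` (when the remainder vanishes and `x′ ≠ 0` one takes `r = x′`;
when `x′ = 0` one takes `r = x`). [cite: Clark2015EuclideanOrderTypes, Thm. 22 (b) (proof) and (1.11)] -/
theorem exists_remainder_le_of_extended (τ : R → Ordinal.{u})
    (hτ : ∀ a b : R, b ≠ 0 → ∃ q r : R, a = b * q + r ∧ (r = 0 ∨ τ r < τ b))
    (h0 : ∀ x : R, x ≠ 0 → τ x < τ 0) (x x' : R) :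
    ∃ q r : R, x = x' * q + r ∧ τ r ≤ τ x' ∧ (τ r < τ x' ∨ x' ∣ x) := by
  by_cases hx' : x' = 0
  · subst hx'
    by_cases hx : x = 0
    · exact ⟨0, x, by ring, by rw [hx], Or.inr (by rw [hx])⟩
    · exact ⟨0, x, by ring, (h0 x hx).le, Or.inl (h0 x hx)⟩
  · obtain ⟨q, r, hqr, hr⟩ := hτ x x' hx'
    rcases hr with rfl | hr
    · exact ⟨q - 1, x', by rw [hqr]; ring, le_rfl, Or.inr ⟨q, by rw [hqr]; ring⟩⟩
    · exact ⟨q, r, hqr, hr.le, Or.inl hr⟩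

/-- **Lemma 9 ([Nagata85]).** «Let `R₁, R₂` be commutative rings, `X₁, X₂` be Artinian ordered classes, and
`φ₁ : R₁ → X₁`, `φ₂ : R₂ → X₂` be generalized Euclidean functions.  Then `φ₁ × φ₂ : R₁ × R₂ → X₁ × X₂` is a generalized
Euclidean function» (for the product order) — here for extended functions with the top value at `0` (Clark's
convention (1.11), which the printed case analysis uses: «Case 2: Suppose `r₁ = 0`, `y₁ ≠ 0` … take `q = (q₁ − 1, q₂)` and
`r = (y₁, r₂)`»). [cite: Clark2015EuclideanOrderTypes, Lemma 9 and (1.11)] -/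
theorem Prod.exists_remainder_prod_lt (τR : R → Ordinal.{u}) (τS : S → Ordinal.{u})
    (hR : ∀ a b : R, b ≠ 0 → ∃ q r : R, a = b * q + r ∧ (r = 0 ∨ τR r < τR b))
    (hS : ∀ a b : S, b ≠ 0 → ∃ q r : S, a = b * q + r ∧ (r = 0 ∨ τS r < τS b))
    (hR0 : ∀ x : R, x ≠ 0 → τR x < τR 0) (hS0 : ∀ y : S, y ≠ 0 → τS y < τS 0) :
    ∀ a b : R × S, b ≠ 0 → ∃ q r : R × S, a = b * q + r ∧
      (r = 0 ∨ ((τR r.1, τS r.2) : Ordinal.{u} × Ordinal.{u}) < (τR b.1, τS b.2)) := by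
  rintro ⟨x, y⟩ ⟨x', y'⟩ hb
  by_cases hdvd : ((x', y') : R × S) ∣ (x, y)
  · obtain ⟨q, hq⟩ := hdvd
    exact ⟨q, 0, by rw [hq, add_zero], Or.inl rfl⟩
  · obtain ⟨q₁, r₁, h₁, hle₁, hlt₁⟩ := exists_remainder_le_of_extended τR hR hR0 x x'
    obtain ⟨q₂, r₂, h₂, hle₂, hlt₂⟩ := exists_remainder_le_of_extended τS hS hS0 y y'
    refine ⟨(q₁, q₂), (r₁, r₂), Prod.ext (by simpa using h₁) (by simpa using h₂), Or.inr ?_⟩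
    rcases hlt₁ with hlt₁ | hd₁
    · exact Prod.lt_iff.2 (Or.inl ⟨hlt₁, hle₂⟩)
    · rcases hlt₂ with hlt₂ | hd₂
      · exact Prod.lt_iff.2 (Or.inr ⟨hle₁, hlt₂⟩)
      · exfalso
        obtain ⟨c₁, hc₁⟩ := hd₁
        obtain ⟨c₂, hc₂⟩ := hd₂
        exact hdvd ⟨(c₁, c₂), Prod.ext (by simpa using hc₁) (by simpa using hc₂)⟩

/-- **Lemma 7.** «Let `X, Y` be Artinian ordered classes, `φ : R → X` a generalized Euclidean function and `f : X → Y` an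
isotone map.  Then `f ∘ φ : R → Y` is a generalized Euclidean function.» [cite: Clark2015EuclideanOrderTypes, Lemma 7] -/
theorem exists_remainder_comp_of_strictMono {T : Type*} [CommRing T] {X Y : Type*} [Preorder X] [Preorder Y]
    (φ : T → X) (hφ : ∀ a b : T, b ≠ 0 → ∃ q r : T, a = b * q + r ∧ (r = 0 ∨ φ r < φ b)) (f : X → Y)
    (hf : StrictMono f) : ∀ a b : T, b ≠ 0 → ∃ q r : T, a = b * q + r ∧ (r = 0 ∨ f (φ r) < f (φ b)) := by
  intro a b hb
  obtain ⟨q, r, hqr, hr⟩ := hφ a b hb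
  exact ⟨q, r, hqr, hr.imp id fun h ↦ hf h⟩

/-- **«thus a Euclidean function `λ ∘ (φ₁ × φ₂) : R → e(R₁) ⊕ e(R₂)`»**: composing Lemma 9 with the isotone map
`(α, β) ↦ α ⊕ β` (the length function of `Ord × Ord`, `nadd_strictMono`), `(x, y) ↦ τ_R(x) ⊕ τ_S(y)` divides with
`r = 0` or a strictly smaller natural sum. [cite: Clark2015EuclideanOrderTypes, Thm. 22 (b) (proof), Lemma 7, Lemma 9] -/
theorem Prod.exists_remainder_nadd_lt (τR : R → Ordinal.{u}) (τS : S → Ordinal.{u})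
    (hR : ∀ a b : R, b ≠ 0 → ∃ q r : R, a = b * q + r ∧ (r = 0 ∨ τR r < τR b))
    (hS : ∀ a b : S, b ≠ 0 → ∃ q r : S, a = b * q + r ∧ (r = 0 ∨ τS r < τS b))
    (hR0 : ∀ x : R, x ≠ 0 → τR x < τR 0) (hS0 : ∀ y : S, y ≠ 0 → τS y < τS 0) :
    ∀ a b : R × S, b ≠ 0 → ∃ q r : R × S, a = b * q + r ∧
      (r = 0 ∨ nadd (τR r.1) (τS r.2) < nadd (τR b.1) (τS b.2)) :=
  exists_remainder_comp_of_strictMono (fun z : R × S ↦ ((τR z.1, τS z.2) : Ordinal.{u} × Ordinal.{u}))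
    (Prod.exists_remainder_prod_lt τR τS hR hS hR0 hS0) (fun p ↦ nadd p.1 p.2) fun _ _ h ↦ nadd_strictMono h

end Division

/-! ## §2 Theorem 22 (b): `e(R × S) ≤ e(R) ⊕ e(S)` -/

section UpperBound

variable {R S : Type u} [CommRing R] [CommRing S]

/-- Clark's extended bottom function `φ_R` («`φ_R = θ − 1`» on `R•`, any value at `0`) divides with
`r = 0 ∨ φ_R(r) < φ_R(b)`. [cite: Clark2015EuclideanOrderTypes, §2.1 (1.11) and §2.5] -/
theorem exists_remainder_of_extended_bottom (hR : ∀ x : R, ∃ α : Ordinal.{u}, x ∈ samuelSet R α)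
    (τ : R → Ordinal.{u}) (hτ : ∀ x : R, x ≠ 0 → τ x = samuelRank x - 1) :
    ∀ a b : R, b ≠ 0 → ∃ q r : R, a = b * q + r ∧ (r = 0 ∨ τ r < τ b) := by
  intro a b hb
  obtain ⟨q, r, hqr, hr⟩ := samuelRank_isAlgorithm hR a b hb
  refine ⟨q, r, hqr, ?_⟩
  by_cases hr0 : r = 0
  · exact Or.inl hr0
  · right
    rw [hτ r hr0, hτ b hb]
    have h : 1 + (samuelRank r - 1) < 1 + (samuelRank b - 1) := by
      rw [one_add_samuelRank_sub_one hR hr0, one_add_samuelRank_sub_one hR hb]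
      exact hr
    exact (add_lt_add_iff_left 1).1 h

/-- With the top value `e(R)` at `0`, the extended bottom function satisfies `φ_R(x) < φ_R(0)` for `x ≠ 0`
(«`φ(0) = sup_{x ≠ 0} φ(x) + 1`»). [cite: Clark2015EuclideanOrderTypes, (1.11)] -/
theorem extended_bottom_lt_zero (τ : R → Ordinal.{u}) (h0 : τ 0 = ⨆ z : R, (samuelRank z - 1 + 1))
    (hτ : ∀ x : R, x ≠ 0 → τ x = samuelRank x - 1) (x : R) (hx : x ≠ 0) : τ x < τ 0 := by
  rw [hτ x hx, h0]
  exact samuelRank_sub_one_lt_iSup x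

/-- **Theorem 22 (b), upper bound: `e(R × S) ≤ e(R) ⊕ e(S)`** for commutative rings `R`, `S` exhausted by their
transfinite constructions: `1 + (φ_R ⊕ φ_S)` is an (ordinal-valued, Samuel) algorithm on `R × S`, so
`θ_{R×S} − 1 ≤ φ_R ⊕ φ_S < e(R) ⊕ e(S)` off `0`. [cite: Clark2015EuclideanOrderTypes, Thm. 22 (b) (upper bound)] -/
theorem Prod.iSup_samuelRank_le_nadd (hR : ∀ x : R, ∃ α : Ordinal.{u}, x ∈ samuelSet R α)
    (hS : ∀ y : S, ∃ α : Ordinal.{u}, y ∈ samuelSet S α) :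
    (⨆ z : R × S, (samuelRank z - 1 + 1)) ≤
      nadd (⨆ x : R, (samuelRank x - 1 + 1)) (⨆ y : S, (samuelRank y - 1 + 1)) := by
  classical
  set eR : Ordinal.{u} := ⨆ x : R, (samuelRank x - 1 + 1) with heR
  set eS : Ordinal.{u} := ⨆ y : S, (samuelRank y - 1 + 1) with heS
  -- Clark's extended bottom functions
  set τR : R → Ordinal.{u} := fun x ↦ if x = 0 then eR else samuelRank x - 1 with hτR
  set τS : S → Ordinal.{u} := fun y ↦ if y = 0 then eS else samuelRank y - 1 with hτS
  have hτR0 : τR 0 = eR := by rw [hτR]; exact if_pos rfl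
  have hτS0 : τS 0 = eS := by rw [hτS]; exact if_pos rfl
  have hτR1 : ∀ x : R, x ≠ 0 → τR x = samuelRank x - 1 := fun x hx ↦ by rw [hτR]; exact if_neg hx
  have hτS1 : ∀ y : S, y ≠ 0 → τS y = samuelRank y - 1 := fun y hy ↦ by rw [hτS]; exact if_neg hy
  have hdiv := Prod.exists_remainder_nadd_lt τR τS (exists_remainder_of_extended_bottom hR τR hτR1)
    (exists_remainder_of_extended_bottom hS τS hτS1) (extended_bottom_lt_zero τR hτR0 hτR1)
    (extended_bottom_lt_zero τS hτS0 hτS1)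
  -- the Samuel algorithm `ψ = 1 + (τR ⊕ τS)` off `0`, `ψ(0) = 0`
  set ψ : R × S → Ordinal.{u} := fun z ↦ if z = 0 then 0 else 1 + nadd (τR z.1) (τS z.2) with hψ
  have hψalg : ∀ a b : R × S, b ≠ 0 → ∃ q r : R × S, a = b * q + r ∧ ψ r < ψ b := by
    intro a b hb
    obtain ⟨q, r, hqr, hr⟩ := hdiv a b hb
    refine ⟨q, r, hqr, ?_⟩
    have hb' : ψ b = 1 + nadd (τR b.1) (τS b.2) := by rw [hψ]; exact if_neg hb
    rw [hb']
    by_cases hr0 : r = 0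
    · rw [hr0, hψ]
      simp only [if_true]
      exact lt_of_lt_of_le zero_lt_one le_self_add
    · rcases hr with h | h
      · exact absurd h hr0
      · have hr' : ψ r = 1 + nadd (τR r.1) (τS r.2) := by rw [hψ]; exact if_neg hr0
        rw [hr']
        exact (add_lt_add_iff_left 1).2 h
  -- `θ ≤ ψ`, hence `θ(z) − 1 ≤ τR(z.1) ⊕ τS(z.2) < eR ⊕ eS` for `z ≠ 0`
  refine Ordinal.iSup_le fun z ↦ ?_
  by_cases hz : z = 0
  · subst hz
    rw [samuelRank_zero, Ordinal.zero_sub, zero_add]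
    exact (Order.one_le_iff_ne_zero.2 iSup_samuelRank_ne_zero).trans (le_nadd_self eR eS)
  · have hψz : ψ z = 1 + nadd (τR z.1) (τS z.2) := by rw [hψ]; exact if_neg hz
    have hθ : samuelRank z ≤ 1 + nadd (τR z.1) (τS z.2) := by
      rw [← hψz]
      exact samuelRank_le_apply ψ hψalg z
    have hsub : samuelRank z - 1 ≤ nadd (τR z.1) (τS z.2) := Ordinal.sub_le.2 hθ
    -- every value is at most the top value, strictly for a non-zero coordinate
    have h1 : τR z.1 ≤ eR := by
      by_cases h : z.1 = 0
      · rw [h, hτR0]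
      · rw [← hτR0]; exact (extended_bottom_lt_zero τR hτR0 hτR1 z.1 h).le
    have h2 : τS z.2 ≤ eS := by
      by_cases h : z.2 = 0
      · rw [h, hτS0]
      · rw [← hτS0]; exact (extended_bottom_lt_zero τS hτS0 hτS1 z.2 h).le
    have hlt : nadd (τR z.1) (τS z.2) < nadd eR eS := by
      by_cases h : z.1 = 0
      · have h' : z.2 ≠ 0 := fun h' ↦ hz (Prod.ext h h')
        have h2' : τS z.2 < eS := by rw [← hτS0]; exact extended_bottom_lt_zero τS hτS0 hτS1 z.2 h'
        exact (nadd_le_nadd_right h1 _).trans_lt (nadd_lt_nadd_left h2' _)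
      · have h1' : τR z.1 < eR := by rw [← hτR0]; exact extended_bottom_lt_zero τR hτR0 hτR1 z.1 h
        exact (nadd_lt_nadd_right h1' _).trans_le (nadd_le_nadd_left h2 _)
    exact Order.add_one_le_iff.2 (hsub.trans_lt hlt)

/-- **Theorem 22 (b) for two factors, both bounds: `e(R) + e(S) ≤ e(R × S) ≤ e(R) ⊕ e(S)`** (non-trivial commutative
rings exhausted by their constructions). [cite: Clark2015EuclideanOrderTypes, Thm. 22 (b), (7)] -/
theorem Prod.add_le_iSup_samuelRank_le_nadd [Nontrivial R] [Nontrivial S]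
    (hR : ∀ x : R, ∃ α : Ordinal.{u}, x ∈ samuelSet R α) (hS : ∀ y : S, ∃ α : Ordinal.{u}, y ∈ samuelSet S α) :
    (⨆ x : R, (samuelRank x - 1 + 1)) + (⨆ y : S, (samuelRank y - 1 + 1)) ≤
        ⨆ z : R × S, (samuelRank z - 1 + 1) ∧
      (⨆ z : R × S, (samuelRank z - 1 + 1)) ≤
        nadd (⨆ x : R, (samuelRank x - 1 + 1)) (⨆ y : S, (samuelRank y - 1 + 1)) :=
  ⟨iSup_samuelRank_add_iSup_samuelRank_le_prod hR hS, Prod.iSup_samuelRank_le_nadd hR hS⟩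

end UpperBound

/-! ## §3 Exact values when one factor has finite order type -/

section Finite

variable {R S : Type u} [CommRing R] [CommRing S]

/-- **`e(S) < ω ⟹ e(R × S) = e(R) + e(S)`** (the two bounds of Theorem 22 (b) meet, by Prop. 4 (a)
`α ⊕ n = α + n`): the mechanism of Theorem 25 a) «`e(R′ × A) = e(R′) + ℓ(A)`».
[cite: Clark2015EuclideanOrderTypes, Thm. 22 (b), Prop. 4 (a), Thm. 25 (a)] -/
theorem Prod.iSup_samuelRank_eq_add_of_lt_omega0 [Nontrivial R] [Nontrivial S]
    (hR : ∀ x : R, ∃ α : Ordinal.{u}, x ∈ samuelSet R α) (hS : ∀ y : S, ∃ α : Ordinal.{u}, y ∈ samuelSet S α)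
    (hfin : (⨆ y : S, (samuelRank y - 1 + 1)) < ω) :
    (⨆ z : R × S, (samuelRank z - 1 + 1)) =
      (⨆ x : R, (samuelRank x - 1 + 1)) + ⨆ y : S, (samuelRank y - 1 + 1) := by
  obtain ⟨h₁, h₂⟩ := Prod.add_le_iSup_samuelRank_le_nadd hR hS
  rw [nadd_eq_add_of_lt_omega0 _ hfin] at h₂
  exact le_antisymm h₂ h₁

/-- `S` finite (and exhausted): `e(R × S) = e(R) + e(S)` with `e(S) < ω` (Fletcher: finitely many ideals).
[cite: Clark2015EuclideanOrderTypes, Thm. 25 (a) and Cor. 17 (a)] -/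
theorem Prod.iSup_samuelRank_eq_add_of_finite [Nontrivial R] [Nontrivial S] [Finite S]
    (hR : ∀ x : R, ∃ α : Ordinal.{u}, x ∈ samuelSet R α) (hS : ∀ y : S, ∃ α : Ordinal.{u}, y ∈ samuelSet S α) :
    (⨆ z : R × S, (samuelRank z - 1 + 1)) =
      (⨆ x : R, (samuelRank x - 1 + 1)) + ⨆ y : S, (samuelRank y - 1 + 1) :=
  Prod.iSup_samuelRank_eq_add_of_lt_omega0 hR hS (iSup_samuelRank_lt_omega0_of_finite hS)

/-- **`e(R × K) = e(R) + 1`** for `K` a field (every non-zero element a unit; `e(K) = 1`).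
[cite: Clark2015EuclideanOrderTypes, Thm. 22 (b), Prop. 4 (a)] -/
theorem Prod.iSup_samuelRank_eq_add_one_of_field [Nontrivial R] [Nontrivial S]
    (hR : ∀ x : R, ∃ α : Ordinal.{u}, x ∈ samuelSet R α) (hS : ∀ y : S, y ≠ 0 → IsUnit y) :
    (⨆ z : R × S, (samuelRank z - 1 + 1)) = (⨆ x : R, (samuelRank x - 1 + 1)) + 1 := by
  have hS' : ∀ y : S, ∃ α : Ordinal.{u}, y ∈ samuelSet S α := fun y ↦
    ⟨1, by rw [samuelSet_one]; exact (eq_or_ne y 0).imp id (hS y)⟩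
  have h1 : (⨆ y : S, (samuelRank y - 1 + 1)) = 1 := iSup_samuelRank_eq_one_of_field hS
  have h := Prod.iSup_samuelRank_eq_add_of_lt_omega0 hR hS' (by rw [h1]; exact one_lt_omega0)
  rwa [h1] at h

/-- Example: `e(ℤ × ℚ) = ω + 1` (`e(ℤ) = ω`, `e(ℚ) = 1`). [cite: Clark2015EuclideanOrderTypes, Thm. 22 (b) and §2.5
Example («`e(ℤ) = ω`»)] -/
theorem iSup_samuelRank_int_prod_rat : (⨆ z : ℤ × ℚ, (samuelRank z - 1 + 1)) = ω + 1 := by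
  rw [Prod.iSup_samuelRank_eq_add_one_of_field Int.forall_exists_mem_samuelSet
    (fun y hy ↦ isUnit_iff_ne_zero.2 hy), Int.iSup_samuelRank_eq_omega0]

end Finite

end Literature.Algebra.EuclideanDomain
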